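import Literature.Probability.RandomPlanarGeometry.SLEKappaRho
import HarnessLib

/-!
# The left filling of a closed connected unbounded set hanging from `0` is a one-sided configuration

Planar topology for the decomposition of the named fact
`Literature.Probability.RandomPlanarGeometry.SLEKappaRho.exists_measurable_fill_version`
(file `SLEKappaRho`: "`K = F^{ℝ₊}_ℍ(cl K_∞)` of SLE(8/3, ρ) is a random element of `Ω₊`"), after

* G. F. Lawler, O. Schramm, W. Werner, *Conformal restriction: the chordal case*, J. Amer. Math.
  Soc. **16** (2003) 917–955, arXiv:math/0209343 (**[LSW]**, arXiv page numbers), §2 p. 8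
  "Fillings" ("`F^{ℝ₊}_ℍ(A)` denotes the union of `A` with the connected components of `ℍ̄ ∖ A`
  which do not intersect `[0, ∞)`") and §8.1 p. 31 ("Let `Ω₊` denote the set of all closed
  connected sets `K ⊂ ℍ̄` such that `K ∩ ℝ = (−∞, 0]` and `ℍ ∖ K` is connected"), as used in
  Thm. 8.4 (p. 37: "let `K = F^{ℝ₊}_ℍ(cl K_∞)` … Then `K` satisfies the right-sided restriction
  property", a property of random elements of `Ω₊`).

The file `RestrictionSides` proves that the left filling of a TWO-SIDED configuration `K ∈ Ω`
(`cl K ∩ ℝ = {0}`) lies in `Ω₊`. Here the same conclusion is PROVED for the left filling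
`leftFilling F` (file `SLEKappaRho`) of an arbitrary set `F` which is

  closed, contained in `ℍ̄ = {im ≥ 0}`, connected, unbounded, contains `0`, and misses `(0, ∞)`

— exactly what the closure `F = cl K_∞` of the union of the hulls of SLE(8/3, ρ) is almost
surely ([LSW] Lemma 8.3: `K_∞ ∩ (0, ∞) = ∅`, `K_∞` unbounded; `F` may contain any part of
`(−∞, 0]`):

* `Literature.Probability.RandomPlanarGeometry.leftFilling_mem_rightConfigs` — **`F^{ℝ₊}_ℍ(F) ∈ Ω₊`**;
* `Literature.Probability.RandomPlanarGeometry.disjoint_leftFilling_iff_of_isPlusHull` —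
  **`F^{ℝ₊}_ℍ(F) ∩ A = ∅ ⟺ F ∩ A = ∅` for `A ∈ 𝒬₊`** (only `F ∩ (0, ∞) = ∅` is needed), which
  identifies the avoidance events of the filling with those of `F`.

The proofs follow `RestrictionSides`: the mirror double `F ∪ conj F` is closed and symmetric, the
component `R` of `1` in its (open) complement is symmetric and contains `(0, ∞)`, its trace on
`ℍ̄` is the component of `1` in `ℍ̄ ∖ F` (fold a path up with `foldUp z = re z + i |im z|`), so
that `leftFilling F = ℍ̄ ∖ R`; the **crossing lemma** (`x < 0 ⟹ x ∉ R`) is the winding-number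
argument: a path from `1` to `x` off the double folds up to a path `p` in `ℍ̄ ∖ F`, the loop
`p · conj(p⁻¹)` misses `F` and winds once about `0` (the argument increases by
`log(−ix) − log(−i)` above and by `log(i) − log(ix)` below, in total `2πi`), winding numbers are
constant on the connected `F ∋ 0` off the loop (Eilenberg) and vanish at far points of the
unbounded `F`. Connectedness of the filling and of its complement in `ℍ` are then as in
`RestrictionSides`.

Mathlib: `connectedComponentIn`, `IsOpen.connectedComponentIn`,
`IsOpen.isConnected_iff_isPathConnected`, `Homeomorph.image_connectedComponentIn`,
`Complex.log_ofReal_mul`, `Complex.log_I`, `Complex.log_neg_I`. Tree: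
`Literature.Topology.PlaneTopology.wind`, `Path.argInc` (`WindingNumber`, `ArgumentIncrement`),
`Literature.Topology.PlaneTopology.foldUp` (`HalfPlaneArc`), the half-turn lemmas of
`RestrictionSides`.
-/

noncomputable section

open Set Filter Topology Metric Bornology Complex
open UpperHalfPlane (upperHalfPlaneSet isOpen_upperHalfPlaneSet)
open scoped Real NNReal ComplexConjugate
open Literature.Topology.PlaneTopology

namespace Literature.Probability.RandomPlanarGeometry

/-! ### Half turns between points of the two real half-axes -/

/-- **Half a turn above, general endpoints**: along a path from `a` to `b` (`a, b` real) in the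
closed upper half-plane avoiding `0`, the logarithm of `z` increases by `log(−ib) − log(−ia)`
(rotate by `−i` into the slit plane and use the principal logarithm). [folklore] -/
theorem argInc_zero_eq_of_im_nonneg {a b : ℝ} (p : Path (a : ℂ) (b : ℂ)) (him : ∀ t, 0 ≤ (p t).im)
    (h0 : ∀ t, p t ≠ 0) : p.argInc 0 = log (-I * b) - log (-I * a) := by
  unfold Path.argInc
  have hext : ∀ t : ℝ, 0 ≤ (p.extend t).im ∧ p.extend t ≠ 0 := fun t ↦ by
    rw [Path.extend]
    exact ⟨him _, h0 _⟩
  have hlog : HasLogOn (fun t ↦ p.extend t - 0) (Icc 0 1) :=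
    hasLogOn_Icc (p.continuous_extend.continuousOn.sub continuousOn_const)
      fun t _ ↦ by rw [sub_zero]; exact (hext t).2
  have hfun : (fun t ↦ p.extend t - 0) = fun t ↦ I * (-I * p.extend t) := by
    funext t
    rw [sub_zero, ← mul_assoc]
    simp
  have hlog' : HasLogOn (fun t ↦ -I * p.extend t) (Icc 0 1) :=
    ((hasLogOn_const (show (-I : ℂ) ≠ 0 by simp) (Icc (0 : ℝ) 1)).mul hlog).congr
      fun t _ ↦ by simp only [sub_zero]
  rw [hfun, logInc_const_mul I_ne_zero hlog',
    logInc_eq_log_sub_log (f := fun t ↦ -I * p.extend t)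
      (continuousOn_const.mul p.continuous_extend.continuousOn)
      fun t _ ↦ neg_I_mul_mem_slitPlane (hext t).1 (hext t).2]
  simp only [Path.extend_one, Path.extend_zero]

/-- **Half a turn below, general endpoints**: along a path from `b` to `a` (`a, b` real) in the
closed lower half-plane avoiding `0`, the logarithm of `z` increases by `log(ia) − log(ib)`.
[folklore] -/
theorem argInc_zero_eq_of_im_nonpos {a b : ℝ} (p : Path (b : ℂ) (a : ℂ)) (him : ∀ t, (p t).im ≤ 0)
    (h0 : ∀ t, p t ≠ 0) : p.argInc 0 = log (I * a) - log (I * b) := by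
  unfold Path.argInc
  have hext : ∀ t : ℝ, (p.extend t).im ≤ 0 ∧ p.extend t ≠ 0 := fun t ↦ by
    rw [Path.extend]
    exact ⟨him _, h0 _⟩
  have hlog : HasLogOn (fun t ↦ p.extend t - 0) (Icc 0 1) :=
    hasLogOn_Icc (p.continuous_extend.continuousOn.sub continuousOn_const)
      fun t _ ↦ by rw [sub_zero]; exact (hext t).2
  have hfun : (fun t ↦ p.extend t - 0) = fun t ↦ -I * (I * p.extend t) := by
    funext t
    rw [sub_zero, ← mul_assoc]
    simp
  have hlog' : HasLogOn (fun t ↦ I * p.extend t) (Icc 0 1) :=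
    ((hasLogOn_const I_ne_zero (Icc (0 : ℝ) 1)).mul hlog).congr fun t _ ↦ by simp only [sub_zero]
  rw [hfun, logInc_const_mul (show (-I : ℂ) ≠ 0 by simp) hlog',
    logInc_eq_log_sub_log (f := fun t ↦ I * p.extend t)
      (continuousOn_const.mul p.continuous_extend.continuousOn)
      fun t _ ↦ I_mul_mem_slitPlane (hext t).1 (hext t).2]
  simp only [Path.extend_one, Path.extend_zero]

/-- **One full turn**: a path from `a > 0` to `b < 0` in the closed upper half-plane followed by
a path from `b` back to `a` in the closed lower half-plane, both avoiding `0`, form a loop of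
winding number `1` about `0` (`log(−ib) − log(−ia) + log(ia) − log(ib) = 2πi`). [folklore] -/
theorem wind_eq_one_of_halfTurns {a b : ℝ} (ha : 0 < a) (hb : b < 0) (p : Path (a : ℂ) (b : ℂ))
    (p₂ : Path (b : ℂ) (a : ℂ)) (him : ∀ t, 0 ≤ (p t).im) (him₂ : ∀ t, (p₂ t).im ≤ 0)
    (h0 : ∀ t, p t ≠ 0) (h0₂ : ∀ t, p₂ t ≠ 0) :
    wind (fun t ↦ (p.trans p₂).extend t - 0) = 1 := by
  have h0p : (0 : ℂ) ∉ range p := fun ⟨t, ht⟩ ↦ h0 t ht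
  have h0p₂ : (0 : ℂ) ∉ range p₂ := fun ⟨t, ht⟩ ↦ h0₂ t ht
  have h0L : (0 : ℂ) ∉ range (p.trans p₂) := by
    rw [Path.trans_range]
    rintro (h | h)
    exacts [h0p h, h0p₂ h]
  have h := (p.trans p₂).argInc_eq_wind_mul h0L
  rw [Path.argInc_trans p p₂ h0p h0p₂, argInc_zero_eq_of_im_nonneg p him h0,
    argInc_zero_eq_of_im_nonpos p₂ him₂ h0₂] at h
  -- evaluate the four logarithms
  have hb' : 0 < -b := neg_pos.2 hb
  have e1 : -I * (b : ℂ) = ((-b : ℝ) : ℂ) * I := by push_cast; ring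
  have e2 : -I * (a : ℂ) = (a : ℂ) * (-I) := by ring
  have e3 : I * (a : ℂ) = (a : ℂ) * I := by ring
  have e4 : I * (b : ℂ) = ((-b : ℝ) : ℂ) * (-I) := by push_cast; ring
  have hnI : (-I : ℂ) ≠ 0 := by simp
  rw [e1, e2, e3, e4, Complex.log_ofReal_mul hb' I_ne_zero, Complex.log_ofReal_mul ha hnI,
    Complex.log_ofReal_mul ha I_ne_zero, Complex.log_ofReal_mul hb' hnI, Complex.log_I,
    Complex.log_neg_I] at h
  have h' : ((1 : ℤ) : ℂ) * (2 * π * I) = (wind fun t ↦ (p.trans p₂).extend t - 0) * (2 * π * I) := by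
    rw [← h]
    push_cast
    ring
  exact (int_eq_of_mul_two_pi_I_eq h').symm

/-! ### The mirror double `F ∪ conj F` and the component of `1` in its complement -/

section MirrorDouble

variable {F : Set ℂ}

/-- The mirror double of a closed set is closed. [folklore] -/
theorem isClosed_union_conj_preimage (hF : IsClosed F) : IsClosed (F ∪ conj ⁻¹' F) :=
  hF.union (hF.preimage Complex.continuous_conj)

/-- The mirror double is symmetric under conjugation. [folklore] -/
theorem conj_mem_union_conj_preimage_iff {z : ℂ} : conj z ∈ F ∪ conj ⁻¹' F ↔ z ∈ F ∪ conj ⁻¹' F := by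
  simp only [mem_union, mem_preimage, Complex.conj_conj]
  tauto

/-- In the closed upper half-plane the mirror double of a set `F ⊆ ℍ̄` is `F`. [folklore] -/
theorem mem_union_conj_preimage_iff_of_im_nonneg (hsub : F ⊆ {z : ℂ | 0 ≤ z.im}) {z : ℂ}
    (hz : 0 ≤ z.im) : z ∈ F ∪ conj ⁻¹' F ↔ z ∈ F := by
  refine ⟨fun h ↦ h.elim id fun h' ↦ ?_, fun h ↦ Or.inl h⟩
  have h1 : 0 ≤ (conj z).im := hsub h'
  rw [Complex.conj_im] at h1
  have him : z.im = 0 := le_antisymm (by linarith) hz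
  have hcz : conj z = z := Complex.ext (by simp) (by simp [him])
  have h'' : conj z ∈ F := h'
  rwa [hcz] at h''

/-- Positive reals are off the mirror double of a set `F ⊆ ℍ̄` missing `(0, ∞)`. [folklore] -/
theorem ofReal_notMem_union_conj_preimage (hsub : F ⊆ {z : ℂ | 0 ≤ z.im})
    (hpos : ∀ x : ℝ, 0 < x → (x : ℂ) ∉ F) {x : ℝ} (hx : 0 < x) : (x : ℂ) ∉ F ∪ conj ⁻¹' F := by
  rw [mem_union_conj_preimage_iff_of_im_nonneg hsub (by simp)]
  exact hpos x hx

/-- The fold `z ↦ re z + i |im z|` maps the complement of the mirror double into `ℍ̄ ∖ F`.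
[folklore] -/
theorem foldUp_notMem_of_notMem_union_conj_preimage {z : ℂ} (hz : z ∉ F ∪ conj ⁻¹' F) :
    foldUp z ∉ F := by
  intro h
  rcases foldUp_eq_or z with h' | h'
  · exact hz (Or.inl (h' ▸ h))
  · exact hz (Or.inr (show conj z ∈ _ from h' ▸ h))

/-- `1` is off the mirror double. [folklore] -/
theorem one_notMem_union_conj_preimage (hsub : F ⊆ {z : ℂ | 0 ≤ z.im})
    (hpos : ∀ x : ℝ, 0 < x → (x : ℂ) ∉ F) : (1 : ℂ) ∉ F ∪ conj ⁻¹' F := by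
  exact_mod_cast ofReal_notMem_union_conj_preimage hsub hpos one_pos

/-- `1` lies in its component of the complement of the mirror double. [folklore] -/
theorem one_mem_connectedComponentIn_compl (hsub : F ⊆ {z : ℂ | 0 ≤ z.im})
    (hpos : ∀ x : ℝ, 0 < x → (x : ℂ) ∉ F) : (1 : ℂ) ∈ connectedComponentIn (F ∪ conj ⁻¹' F)ᶜ 1 :=
  mem_connectedComponentIn (one_notMem_union_conj_preimage hsub hpos)

/-- The component of `1` off the mirror double of a closed set is open. [folklore] -/
theorem isOpen_connectedComponentIn_compl (hF : IsClosed F) :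
    IsOpen (connectedComponentIn (F ∪ conj ⁻¹' F)ᶜ (1 : ℂ)) :=
  (isClosed_union_conj_preimage hF).isOpen_compl.connectedComponentIn

/-- **The positive real axis lies in the component of `1`** off the mirror double (it is
connected, off the double, through `1`). [folklore] -/
theorem ofReal_mem_connectedComponentIn_compl (hsub : F ⊆ {z : ℂ | 0 ≤ z.im})
    (hpos : ∀ x : ℝ, 0 < x → (x : ℂ) ∉ F) {x : ℝ} (hx : 0 < x) :
    (x : ℂ) ∈ connectedComponentIn (F ∪ conj ⁻¹' F)ᶜ 1 := by
  have hsub' : ((↑) : ℝ → ℂ) '' Ioi 0 ⊆ (F ∪ conj ⁻¹' F)ᶜ := by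
    rintro _ ⟨y, hy, rfl⟩
    exact ofReal_notMem_union_conj_preimage hsub hpos hy
  have hconn : IsPreconnected (((↑) : ℝ → ℂ) '' Ioi 0) :=
    isPreconnected_Ioi.image _ Complex.continuous_ofReal.continuousOn
  have h1 : (1 : ℂ) ∈ ((↑) : ℝ → ℂ) '' Ioi 0 := ⟨1, mem_Ioi.2 zero_lt_one, by simp⟩
  exact (hconn.subset_connectedComponentIn h1 hsub') ⟨x, hx, rfl⟩

/-- **The component of `1` off the mirror double is symmetric under conjugation** (`conj` is a
homeomorphism preserving the double and fixing `1`). [folklore] -/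
theorem conj_mem_connectedComponentIn_compl_iff (hsub : F ⊆ {z : ℂ | 0 ≤ z.im})
    (hpos : ∀ x : ℝ, 0 < x → (x : ℂ) ∉ F) {z : ℂ} :
    conj z ∈ connectedComponentIn (F ∪ conj ⁻¹' F)ᶜ 1 ↔ z ∈ connectedComponentIn (F ∪ conj ⁻¹' F)ᶜ 1 := by
  have key : ∀ w : ℂ, w ∈ connectedComponentIn (F ∪ conj ⁻¹' F)ᶜ 1 →
      conj w ∈ connectedComponentIn (F ∪ conj ⁻¹' F)ᶜ 1 := fun w hw ↦ by
    have himg := Complex.conjCLE.toHomeomorph.image_connectedComponentIn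
      (s := (F ∪ conj ⁻¹' F)ᶜ) (x := 1) (one_notMem_union_conj_preimage hsub hpos)
    have hs : Complex.conjCLE.toHomeomorph '' (F ∪ conj ⁻¹' F)ᶜ = (F ∪ conj ⁻¹' F)ᶜ := by
      ext u
      simp only [mem_image, mem_compl_iff]
      constructor
      · rintro ⟨v, hv, rfl⟩
        change conj v ∉ _
        rwa [conj_mem_union_conj_preimage_iff]
      · intro hu
        refine ⟨conj u, by rwa [conj_mem_union_conj_preimage_iff], ?_⟩
        change conj (conj u) = u
        exact Complex.conj_conj u
    have h1 : Complex.conjCLE.toHomeomorph (1 : ℂ) = 1 := by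
      change conj (1 : ℂ) = 1
      exact map_one _
    rw [hs, h1] at himg
    change conj '' connectedComponentIn (F ∪ conj ⁻¹' F)ᶜ 1 = connectedComponentIn (F ∪ conj ⁻¹' F)ᶜ 1 at himg
    rw [← himg]
    exact ⟨w, hw, rfl⟩
  refine ⟨fun h ↦ ?_, key z⟩
  simpa using key _ h

/-- The fold maps the component of `1` off the mirror double into itself. [folklore] -/
theorem foldUp_mem_connectedComponentIn_compl (hsub : F ⊆ {z : ℂ | 0 ≤ z.im})
    (hpos : ∀ x : ℝ, 0 < x → (x : ℂ) ∉ F) {z : ℂ} (hz : z ∈ connectedComponentIn (F ∪ conj ⁻¹' F)ᶜ 1) :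
    foldUp z ∈ connectedComponentIn (F ∪ conj ⁻¹' F)ᶜ 1 := by
  rcases foldUp_eq_or z with h | h
  · rwa [h]
  · rw [h]
    exact (conj_mem_connectedComponentIn_compl_iff hsub hpos).2 hz

/-- **The trace on `ℍ̄` of the component of `1` off the mirror double is the component of `1` in
`ℍ̄ ∖ F`** (fold a joining path up; a connected subset of `ℍ̄ ∖ F` through `1` misses the
double). [folklore] -/
theorem connectedComponentIn_compl_inter_eq (hF : IsClosed F) (hsub : F ⊆ {z : ℂ | 0 ≤ z.im})
    (hpos : ∀ x : ℝ, 0 < x → (x : ℂ) ∉ F) :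
    connectedComponentIn (F ∪ conj ⁻¹' F)ᶜ 1 ∩ {z : ℂ | 0 ≤ z.im} =
      connectedComponentIn ({z : ℂ | 0 ≤ z.im} \ F) 1 := by
  set R : Set ℂ := connectedComponentIn (F ∪ conj ⁻¹' F)ᶜ 1 with hR
  have hRopen : IsOpen R := isOpen_connectedComponentIn_compl hF
  have hRconn : IsConnected R :=
    ⟨⟨1, one_mem_connectedComponentIn_compl hsub hpos⟩, isPreconnected_connectedComponentIn⟩
  refine Subset.antisymm ?_ ?_
  · rintro z ⟨hz, hzim⟩
    have hpath : IsPathConnected R := hRopen.isConnected_iff_isPathConnected.1 hRconn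
    obtain ⟨q, hq⟩ := hpath.joinedIn 1 (one_mem_connectedComponentIn_compl hsub hpos) z hz
    have hsub' : range (fun t ↦ foldUp (q t)) ⊆ {z : ℂ | 0 ≤ z.im} \ F := by
      rintro _ ⟨t, rfl⟩
      exact ⟨by rw [mem_setOf_eq, foldUp_im]; exact abs_nonneg _,
        foldUp_notMem_of_notMem_union_conj_preimage (connectedComponentIn_subset _ _ (hq t))⟩
    have hconn : IsPreconnected (range fun t ↦ foldUp (q t)) :=
      (isConnected_range (continuous_foldUp.comp q.continuous)).isPreconnected
    have h1 : (1 : ℂ) ∈ range fun t ↦ foldUp (q t) := ⟨0, by simp [foldUp_of_nonneg]⟩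
    have hz' : z ∈ range fun t ↦ foldUp (q t) := ⟨1, by simp [foldUp_of_nonneg hzim]⟩
    exact hconn.subset_connectedComponentIn h1 hsub' hz'
  · intro z hz
    have hsub' : connectedComponentIn ({z : ℂ | 0 ≤ z.im} \ F) 1 ⊆ (F ∪ conj ⁻¹' F)ᶜ := by
      intro w hw
      have hw' := connectedComponentIn_subset _ _ hw
      rw [mem_compl_iff, mem_union_conj_preimage_iff_of_im_nonneg hsub hw'.1]
      exact hw'.2
    have h1 : (1 : ℂ) ∈ {z : ℂ | 0 ≤ z.im} \ F := ⟨by simp, by exact_mod_cast hpos 1 one_pos⟩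
    exact ⟨(isPreconnected_connectedComponentIn.subset_connectedComponentIn
      (mem_connectedComponentIn h1) hsub') hz, (connectedComponentIn_subset _ _ hz).1⟩

/-- The components in `ℍ̄ ∖ F` of the positive reals are all that of `1` (the positive axis is
connected and misses `F`). [folklore] -/
theorem connectedComponentIn_ofReal_eq (hpos : ∀ x : ℝ, 0 < x → (x : ℂ) ∉ F) {x : ℝ} (hx : 0 < x) :
    connectedComponentIn ({z : ℂ | 0 ≤ z.im} \ F) (x : ℂ) = connectedComponentIn ({z : ℂ | 0 ≤ z.im} \ F) 1 := by
  have hsub' : ((↑) : ℝ → ℂ) '' Ioi 0 ⊆ {z : ℂ | 0 ≤ z.im} \ F := by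
    rintro _ ⟨y, hy, rfl⟩
    exact ⟨by simp, hpos y hy⟩
  have hconn : IsPreconnected (((↑) : ℝ → ℂ) '' Ioi 0) :=
    isPreconnected_Ioi.image _ Complex.continuous_ofReal.continuousOn
  have h1 : (1 : ℂ) ∈ ((↑) : ℝ → ℂ) '' Ioi 0 := ⟨1, mem_Ioi.2 zero_lt_one, by simp⟩
  have hx1 : (x : ℂ) ∈ connectedComponentIn ({z : ℂ | 0 ≤ z.im} \ F) 1 :=
    (hconn.subset_connectedComponentIn h1 hsub') ⟨x, hx, rfl⟩
  exact (connectedComponentIn_eq hx1).symm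

/-- **`F^{ℝ₊}_ℍ(F) = ℍ̄ ∖ R`**, `R` the component of `1` off the mirror double, for `F ⊆ ℍ̄` closed
containing `0` and missing `(0, ∞)`: the components of `ℍ̄ ∖ F` of the points of `[0, ∞)` are
that of `1` (and the empty component of `0 ∈ F`). [cite: LawlerSchrammWerner2003Restriction, §2 p. 8 (Fillings)] -/
theorem leftFilling_eq_diff_connectedComponentIn (hF : IsClosed F) (hsub : F ⊆ {z : ℂ | 0 ≤ z.im})
    (h0 : (0 : ℂ) ∈ F) (hpos : ∀ x : ℝ, 0 < x → (x : ℂ) ∉ F) :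
    leftFilling F = {z : ℂ | 0 ≤ z.im} \ connectedComponentIn (F ∪ conj ⁻¹' F)ᶜ 1 := by
  ext z
  rw [mem_leftFilling_iff, Set.mem_sdiff, mem_setOf_eq]
  refine and_congr_right fun hz ↦ ⟨fun h hzR ↦ ?_, fun h x hx hzx ↦ ?_⟩
  · have h1 : z ∈ connectedComponentIn ({z : ℂ | 0 ≤ z.im} \ F) 1 := by
      rw [← connectedComponentIn_compl_inter_eq hF hsub hpos]
      exact ⟨hzR, hz⟩
    exact h 1 zero_le_one (by exact_mod_cast h1)
  · rcases hx.eq_or_lt with rfl | hx'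
    · have hzero : connectedComponentIn ({z : ℂ | 0 ≤ z.im} \ F) ((0 : ℝ) : ℂ) = ∅ :=
        connectedComponentIn_eq_empty fun h' ↦ h'.2 (by exact_mod_cast h0)
      rw [hzero] at hzx
      exact hzx
    · rw [connectedComponentIn_ofReal_eq hpos hx', ← connectedComponentIn_compl_inter_eq hF hsub hpos] at hzx
      exact h hzx.1

/-- A connected subset of `ℍ̄ ∖ F` meeting the component of `1` off the mirror double lies in it.
[folklore] -/
theorem subset_connectedComponentIn_compl_of_isPreconnected (hF : IsClosed F)
    (hsub : F ⊆ {z : ℂ | 0 ≤ z.im}) (hpos : ∀ x : ℝ, 0 < x → (x : ℂ) ∉ F) {T : Set ℂ}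
    (hT : IsPreconnected T) (hTsub : T ⊆ {z : ℂ | 0 ≤ z.im} \ F) {w : ℂ} (hwT : w ∈ T)
    (hw : w ∈ connectedComponentIn (F ∪ conj ⁻¹' F)ᶜ 1) :
    T ⊆ connectedComponentIn (F ∪ conj ⁻¹' F)ᶜ 1 := by
  have hw' : w ∈ connectedComponentIn ({z : ℂ | 0 ≤ z.im} \ F) 1 := by
    rw [← connectedComponentIn_compl_inter_eq hF hsub hpos]
    exact ⟨hw, (hTsub hwT).1⟩
  intro z hz
  have h := hT.subset_connectedComponentIn hwT hTsub hz
  rw [← connectedComponentIn_eq hw', ← connectedComponentIn_compl_inter_eq hF hsub hpos] at h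
  exact h.1

/-! ### The crossing lemma -/

/-- **Crossing lemma.** If `F ⊆ ℍ̄` is closed, connected, unbounded, contains `0` and misses
`(0, ∞)`, then no negative real lies in the component of `1` off the mirror double: `F` separates
the negative from the positive real axis inside `ℍ̄`. Winding-number proof, see the module
docstring. [folklore] -/
theorem ofReal_notMem_connectedComponentIn_compl (hsub : F ⊆ {z : ℂ | 0 ≤ z.im})
    (hconn : IsConnected F) (h0 : (0 : ℂ) ∈ F) (hunb : ¬ IsBounded F)
    (hpos : ∀ x : ℝ, 0 < x → (x : ℂ) ∉ F) (hF : IsClosed F) {x : ℝ} (hx : x < 0) :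
    (x : ℂ) ∉ connectedComponentIn (F ∪ conj ⁻¹' F)ᶜ 1 := by
  intro hneg
  set R : Set ℂ := connectedComponentIn (F ∪ conj ⁻¹' F)ᶜ 1 with hR
  have hRopen : IsOpen R := isOpen_connectedComponentIn_compl hF
  have hRconn : IsConnected R :=
    ⟨⟨1, one_mem_connectedComponentIn_compl hsub hpos⟩, isPreconnected_connectedComponentIn⟩
  -- a path from `1` to `x` off the double, folded up into `ℍ̄ ∖ F`
  have hpath : IsPathConnected R := hRopen.isConnected_iff_isPathConnected.1 hRconn
  obtain ⟨q, hq⟩ := hpath.joinedIn 1 (one_mem_connectedComponentIn_compl hsub hpos) x hneg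
  have hqF : ∀ t, q t ∉ F ∪ conj ⁻¹' F := fun t ↦ connectedComponentIn_subset _ _ (hq t)
  let p : Path (((1 : ℝ) : ℂ)) (x : ℂ) :=
    { toFun := fun t ↦ foldUp (q t)
      continuous_toFun := continuous_foldUp.comp q.continuous
      source' := by simp [foldUp_of_nonneg]
      target' := by simp [foldUp_of_nonneg] }
  have hp_im : ∀ t, 0 ≤ (p t).im := fun t ↦ by
    show 0 ≤ (foldUp (q t)).im
    rw [foldUp_im]
    exact abs_nonneg _
  have hp_F : ∀ t, p t ∉ F := fun t ↦ foldUp_notMem_of_notMem_union_conj_preimage (hqF t)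
  have hp_0 : ∀ t, p t ≠ 0 := fun t h ↦ hp_F t (h ▸ h0)
  -- the mirror path from `x` back to `1`, below the axis
  let p₂ : Path (x : ℂ) (((1 : ℝ) : ℂ)) :=
    { toFun := fun t ↦ conj (p.symm t)
      continuous_toFun := Complex.continuous_conj.comp p.symm.continuous
      source' := by simp [Complex.conj_ofReal]
      target' := by simp }
  have hp₂_im : ∀ t, (p₂ t).im ≤ 0 := fun t ↦ by
    change (conj (p (unitInterval.symm t))).im ≤ 0
    rw [Complex.conj_im, neg_nonpos]
    exact hp_im _
  have hp₂_F : ∀ t, p₂ t ∉ F := fun t h ↦ by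
    -- `conj (p s) ∈ F ⊆ {Im ≥ 0}` forces it real, hence equal to `p s ∈ F`
    change conj (p (unitInterval.symm t)) ∈ F at h
    set w : ℂ := p (unitInterval.symm t) with hw
    have h1 : 0 ≤ (conj w).im := hsub h
    rw [Complex.conj_im] at h1
    have him : w.im = 0 := le_antisymm (by linarith) (hp_im _)
    have hcw : conj w = w := Complex.ext (by simp) (by simp [him])
    rw [hcw] at h
    exact hp_F _ h
  have hp₂_0 : ∀ t, p₂ t ≠ 0 := fun t h ↦ hp₂_F t (h ▸ h0)
  -- the loop and its winding number about `0`
  let L : Path (((1 : ℝ) : ℂ)) (((1 : ℝ) : ℂ)) := p.trans p₂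
  have h0p : (0 : ℂ) ∉ range p := fun ⟨t, ht⟩ ↦ hp_0 t ht
  have h0p₂ : (0 : ℂ) ∉ range p₂ := fun ⟨t, ht⟩ ↦ hp₂_0 t ht
  have hLF : Disjoint (range L) F := by
    rw [Path.trans_range, Set.disjoint_left]
    rintro _ (⟨t, rfl⟩ | ⟨t, rfl⟩)
    exacts [hp_F t, hp₂_F t]
  have hwind1 : wind (fun t ↦ L.extend t - 0) = 1 :=
    wind_eq_one_of_halfTurns one_pos hx p p₂ hp_im hp₂_im hp_0 hp₂_0
  -- `F` lies in the component of `0` off the loop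
  have hFcomp : F ⊆ connectedComponentIn (range L)ᶜ 0 :=
    hconn.isPreconnected.subset_connectedComponentIn h0 (Set.disjoint_left.1 hLF.symm)
  -- a far point of `F`
  obtain ⟨R₀, hR₀⟩ := (isCompact_range L.continuous).isBounded.subset_closedBall 0
  obtain ⟨f, hfF, hfR⟩ : ∃ f ∈ F, f ∉ closedBall (0 : ℂ) (max R₀ 0) := by
    by_contra hcon
    push Not at hcon
    exact hunb (isBounded_closedBall.subset hcon)
  rw [mem_closedBall, dist_zero_right, not_le] at hfR
  have hfcomp : f ∈ connectedComponentIn (range L)ᶜ 0 := hFcomp hfF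
  -- winding numbers about `0` and about `f` agree, but the latter vanishes
  have hmaps : MapsTo L.extend (Icc 0 1) (range L) := fun t ht ↦ by
    rw [Path.extend_apply L ht]
    exact mem_range_self _
  have heq := wind_sub_eq_of_mem_connectedComponentIn L.continuous_extend.continuousOn
    (by simp) (isCompact_range L.continuous).isClosed hmaps hfcomp
  have hzero : wind (fun t ↦ L.extend t - f) = 0 := by
    have hlog := hasLogOn_sub_of_lt_norm (le_max_right R₀ 0) hfR
    have hmaps' : MapsTo L.extend (Icc 0 1) (closedBall 0 (max R₀ 0)) := fun t ht ↦
      (closedBall_subset_closedBall (le_max_left _ _)) (hR₀ (hmaps ht))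
    exact wind_comp_eq_zero_of_hasLogOn hlog L.continuous_extend.continuousOn hmaps' (by simp)
  rw [hwind1, hzero] at heq
  exact one_ne_zero heq

/-! ### The left filling is a one-sided configuration -/

/-- **`F^{ℝ₊}_ℍ(F) ∩ ℝ = (−∞, 0]`**: positive reals are in their own component, nonpositive ones
are in `F` or cut off from `[0, ∞)` by the crossing lemma.
[cite: LawlerSchrammWerner2003Restriction, §8.1 p. 31 (K ∩ ℝ = (−∞, 0] for K ∈ Ω₊)] -/
theorem ofReal_mem_leftFilling_iff (hF : IsClosed F) (hsub : F ⊆ {z : ℂ | 0 ≤ z.im})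
    (hconn : IsConnected F) (h0 : (0 : ℂ) ∈ F) (hunb : ¬ IsBounded F)
    (hpos : ∀ x : ℝ, 0 < x → (x : ℂ) ∉ F) {x : ℝ} : (x : ℂ) ∈ leftFilling F ↔ x ≤ 0 := by
  constructor
  · intro h
    by_contra h'
    exact ofReal_notMem_leftFilling (not_le.1 h').le (hpos x (not_le.1 h')) h
  · intro hx
    rw [leftFilling_eq_diff_connectedComponentIn hF hsub h0 hpos]
    refine ⟨by simp, ?_⟩
    rcases hx.lt_or_eq with hx' | rfl
    · exact ofReal_notMem_connectedComponentIn_compl hsub hconn h0 hunb hpos hF hx'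
    · exact fun h' ↦ connectedComponentIn_subset _ _ h' (Or.inl (by exact_mod_cast h0))

/-- `F^{ℝ₊}_ℍ(F) ∩ ℝ = (−∞, 0]` as sets. [cite: LawlerSchrammWerner2003Restriction, §8.1 p. 31] -/
theorem leftFilling_inter_range_ofReal (hF : IsClosed F) (hsub : F ⊆ {z : ℂ | 0 ≤ z.im})
    (hconn : IsConnected F) (h0 : (0 : ℂ) ∈ F) (hunb : ¬ IsBounded F)
    (hpos : ∀ x : ℝ, 0 < x → (x : ℂ) ∉ F) :
    leftFilling F ∩ range ((↑) : ℝ → ℂ) = nonposAxis := by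
  ext z
  constructor
  · rintro ⟨hz, ⟨x, rfl⟩⟩
    exact ⟨x, (ofReal_mem_leftFilling_iff hF hsub hconn h0 hunb hpos).1 hz, rfl⟩
  · rintro ⟨x, hx, rfl⟩
    exact ⟨(ofReal_mem_leftFilling_iff hF hsub hconn h0 hunb hpos).2 hx, ⟨x, rfl⟩⟩

/-- **`F^{ℝ₊}_ℍ(F)` is connected** (`F` connected together with the other components of `ℍ̄ ∖ F`,
none of which can be split off: a piece of the filling closed in `ℂ` and missing `F` would be
relatively open in the connected `ℍ̄`). [cite: LawlerSchrammWerner2003Restriction, §8.1 p. 31 (Ω₊: closed connected sets)] -/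
theorem isConnected_leftFilling (hF : IsClosed F) (hsub : F ⊆ {z : ℂ | 0 ≤ z.im})
    (hconn : IsConnected F) (h0 : (0 : ℂ) ∈ F) (hpos : ∀ x : ℝ, 0 < x → (x : ℂ) ∉ F) :
    IsConnected (leftFilling F) := by
  have hFL : F ⊆ leftFilling F := fun z hz ↦ inter_subset_leftFilling F ⟨hz, hsub hz⟩
  refine ⟨⟨0, hFL h0⟩, ?_⟩
  rw [isPreconnected_iff_subset_of_disjoint_closed]
  intro u v hu hv hcover hdisj
  set H : Set ℂ := {z : ℂ | 0 ≤ z.im} with hH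
  set R : Set ℂ := connectedComponentIn (F ∪ conj ⁻¹' F)ᶜ 1 with hR
  have hLeq : leftFilling F = H \ R := leftFilling_eq_diff_connectedComponentIn hF hsub h0 hpos
  have hHconn : IsPreconnected H := (convex_halfSpace_im_ge (0 : ℝ)).isPreconnected
  -- `F` is connected, so it lies in `u` or in `v`; by symmetry in `u`
  have hFuv : F ⊆ u ∨ F ⊆ v := by
    refine isPreconnected_iff_subset_of_disjoint_closed.1 hconn.isPreconnected u v hu hv
      (hFL.trans hcover) ?_
    rw [← subset_empty_iff, ← hdisj]
    exact inter_subset_inter_left _ hFL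
  wlog hFu : F ⊆ u generalizing u v
  · exact (this v u hv hu (by rwa [union_comm v u]) (by rwa [inter_comm v u]) hFuv.symm
      (hFuv.resolve_left hFu)).symm
  left
  -- the piece `Y = Fill ∩ v` is closed, misses `u ⊇ F`, and is relatively open in `ℍ̄`
  set Y : Set ℂ := leftFilling F ∩ v with hY
  have hYc : IsClosed Y := (isClosed_leftFilling hF).inter hv
  have hYu : ∀ y ∈ Y, y ∉ u := fun y hy hyu ↦ by
    have : y ∈ leftFilling F ∩ (u ∩ v) := ⟨hy.1, hyu, hy.2⟩
    rw [hdisj] at this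
    exact this
  have hYopen : ∀ y ∈ Y, ∃ r > 0, ball y r ∩ H ⊆ Y := by
    intro y hy
    have hyF : y ∉ F := fun h ↦ hYu y hy (hFu h)
    obtain ⟨r, hr, hrsub⟩ := Metric.isOpen_iff.1 (hu.union hF).isOpen_compl y
      (fun h ↦ h.elim (hYu y hy) hyF)
    refine ⟨r, hr, fun w hw ↦ ?_⟩
    have hwu : w ∉ u := fun h ↦ hrsub hw.1 (Or.inl h)
    -- `w ∉ R`: otherwise the convex set `ball y r ∩ ℍ̄ ⊆ ℍ̄ ∖ F` would lie in `R`
    have hwR : w ∉ R := fun hwR ↦ by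
      have hsub' : ball y r ∩ H ⊆ R :=
        subset_connectedComponentIn_compl_of_isPreconnected hF hsub hpos
          ((convex_ball y r).inter (convex_halfSpace_im_ge (0 : ℝ))).isPreconnected
          (fun z hz ↦ ⟨hz.2, fun h ↦ hrsub hz.1 (Or.inr h)⟩) hw hwR
      have hy' : y ∈ H \ R := hLeq ▸ hy.1
      exact hy'.2 (hsub' ⟨mem_ball_self hr, hy'.1⟩)
    have hwL : w ∈ leftFilling F := by
      rw [hLeq]
      exact ⟨hw.2, hwR⟩
    exact ⟨hwL, (hcover hwL).resolve_left hwu⟩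
  -- so `Y = ∅` by connectedness of `ℍ̄` (`1 ∈ ℍ̄ ∖ Y`)
  have hYempty : Y = ∅ := by
    by_contra hne
    obtain ⟨y, hy⟩ := nonempty_iff_ne_empty.2 hne
    choose! r hr hrY using hYopen
    set O : Set ℂ := ⋃ y ∈ Y, ball y (r y) with hO
    have hOo : IsOpen O := isOpen_biUnion fun _ _ ↦ isOpen_ball
    have h1 : (1 : ℂ) ∈ H ∩ Yᶜ := ⟨by simp [hH], fun h ↦ by
      have h1' : (1 : ℂ) ∈ H \ R := hLeq ▸ h.1
      exact h1'.2 (one_mem_connectedComponentIn_compl hsub hpos)⟩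
    obtain ⟨z, hzH, hzO, hzY⟩ := hHconn O Yᶜ hOo hYc.isOpen_compl
      (fun z hz ↦ by
        by_cases hzY : z ∈ Y
        · exact Or.inl (mem_biUnion hzY (mem_ball_self (hr z hzY)))
        · exact Or.inr hzY)
      ⟨y, (hLeq ▸ hy.1 : y ∈ H \ R).1, mem_biUnion hy (mem_ball_self (hr y hy))⟩ ⟨1, h1⟩
    rw [hO, mem_iUnion₂] at hzO
    obtain ⟨y', hy', hzy'⟩ := hzO
    exact hzY (hrY y' hy' ⟨hzy', hzH⟩)
  intro z hz
  rcases hcover hz with h | h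
  · exact h
  · have : z ∈ Y := ⟨hz, h⟩
    rw [hYempty] at this
    exact absurd this (notMem_empty _)

/-- `ℍ ∖ F^{ℝ₊}_ℍ(F) = ℍ ∩ R`, `R` the component of `1` off the mirror double. [folklore] -/
theorem upperHalfPlaneSet_diff_leftFilling (hF : IsClosed F) (hsub : F ⊆ {z : ℂ | 0 ≤ z.im})
    (h0 : (0 : ℂ) ∈ F) (hpos : ∀ x : ℝ, 0 < x → (x : ℂ) ∉ F) :
    upperHalfPlaneSet \ leftFilling F = upperHalfPlaneSet ∩ connectedComponentIn (F ∪ conj ⁻¹' F)ᶜ 1 := by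
  rw [leftFilling_eq_diff_connectedComponentIn hF hsub h0 hpos]
  ext z
  constructor
  · rintro ⟨hz, h⟩
    refine ⟨hz, ?_⟩
    by_contra h'
    exact h ⟨le_of_lt (show 0 < z.im from hz), h'⟩
  · rintro ⟨hz, h⟩
    exact ⟨hz, fun h' ↦ h'.2 h⟩

/-- **`ℍ ∖ F^{ℝ₊}_ℍ(F)` is connected** ([LSW] §8.1: `ℍ ∖ K` connected for `K ∈ Ω₊`): two points
of `ℍ ∩ R` are joined inside the open connected `R`; fold the path into `ℍ̄` (`R` is symmetric)
and lift it off the real axis by a small `iη`.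
[cite: LawlerSchrammWerner2003Restriction, §8.1 p. 31 (Ω₊: ℍ ∖ K connected)] -/
theorem isConnected_upperHalfPlaneSet_diff_leftFilling (hF : IsClosed F)
    (hsub : F ⊆ {z : ℂ | 0 ≤ z.im}) (h0 : (0 : ℂ) ∈ F) (hpos : ∀ x : ℝ, 0 < x → (x : ℂ) ∉ F) :
    IsConnected (upperHalfPlaneSet \ leftFilling F) := by
  rw [upperHalfPlaneSet_diff_leftFilling hF hsub h0 hpos]
  set R : Set ℂ := connectedComponentIn (F ∪ conj ⁻¹' F)ᶜ 1 with hR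
  have hRopen : IsOpen R := isOpen_connectedComponentIn_compl hF
  have hRconn : IsConnected R :=
    ⟨⟨1, one_mem_connectedComponentIn_compl hsub hpos⟩, isPreconnected_connectedComponentIn⟩
  set M : Set ℂ := upperHalfPlaneSet ∩ R with hM
  have hMopen : IsOpen M := isOpen_upperHalfPlaneSet.inter hRopen
  have hpath : IsPathConnected R := hRopen.isConnected_iff_isPathConnected.1 hRconn
  have hjoin : ∀ x ∈ M, ∀ y ∈ M, JoinedIn M x y := by
    intro x hx y hy
    have hxim : 0 < x.im := hx.1
    have hyim : 0 < y.im := hy.1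
    obtain ⟨p, hp⟩ := hpath.joinedIn x hx.2 y hy.2
    -- the folded path stays in the (symmetric) domain `R`, at positive distance from its complement
    set C : Set ℂ := range (foldUp ∘ p) with hC
    have hCc : IsCompact C := isCompact_range (continuous_foldUp.comp p.continuous)
    have hCR : C ⊆ R := by
      rintro _ ⟨t, rfl⟩
      exact foldUp_mem_connectedComponentIn_compl hsub hpos (hp t)
    obtain ⟨δ, hδ, hδC⟩ := hCc.exists_thickening_subset_open hRopen hCR
    obtain ⟨ρx, hρx, hρxM⟩ := Metric.isOpen_iff.1 hMopen x hx
    obtain ⟨ρy, hρy, hρyM⟩ := Metric.isOpen_iff.1 hMopen y hy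
    set η : ℝ := min (δ / 2) (min (ρx / 2) (ρy / 2)) with hη
    have hη0 : 0 < η := by positivity
    have hηδ : η < δ := (min_le_left _ _).trans_lt (half_lt_self hδ)
    have hηx : η < ρx := ((min_le_right _ _).trans (min_le_left _ _)).trans_lt (half_lt_self hρx)
    have hηy : η < ρy := ((min_le_right _ _).trans (min_le_right _ _)).trans_lt (half_lt_self hρy)
    have hshift : ∀ z : ℂ, dist (z + η * I) z = η := fun z ↦ by
      rw [dist_eq_norm, add_sub_cancel_left, norm_mul, Complex.norm_real, Complex.norm_I, mul_one,
        Real.norm_eq_abs, abs_of_pos hη0]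
    have h1 : JoinedIn M x (x + η * I) := by
      refine JoinedIn.of_segment_subset (((convex_ball x ρx).segment_subset ?_ ?_).trans hρxM)
      · exact mem_ball_self hρx
      · rw [mem_ball, hshift]
        exact hηx
    have h3 : JoinedIn M (y + η * I) y := by
      refine JoinedIn.of_segment_subset (((convex_ball y ρy).segment_subset ?_ ?_).trans hρyM)
      · rw [mem_ball, hshift]
        exact hηy
      · exact mem_ball_self hρy
    have h2 : JoinedIn M (x + η * I) (y + η * I) := by
      let q : Path (x + η * I) (y + η * I) :=
        { toFun := fun t ↦ foldUp (p t) + η * I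
          continuous_toFun := (continuous_foldUp.comp p.continuous).add continuous_const
          source' := by simp [foldUp_of_nonneg hxim.le]
          target' := by simp [foldUp_of_nonneg hyim.le] }
      refine ⟨q, fun t ↦ ⟨?_, ?_⟩⟩
      · show 0 < (foldUp (p t) + η * I).im
        simp only [Complex.add_im, foldUp_im, Complex.mul_im, Complex.ofReal_re, Complex.I_im,
          mul_one, Complex.ofReal_im, Complex.I_re, mul_zero, add_zero]
        positivity
      · show foldUp (p t) + η * I ∈ R
        have : foldUp (p t) + ↑η * I ∈ thickening δ C :=
          Metric.mem_thickening_iff.2 ⟨foldUp (p t), ⟨t, rfl⟩, by rw [hshift]; exact hηδ⟩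
        exact hδC this
    exact (h1.trans h2).trans h3
  -- a point of `M`: just above `1`
  obtain ⟨r, hr, hrR⟩ := Metric.isOpen_iff.1 hRopen 1 (one_mem_connectedComponentIn_compl hsub hpos)
  have hz₀ : (1 : ℂ) + ((r / 2 : ℝ) : ℂ) * I ∈ M := by
    refine ⟨?_, hrR ?_⟩
    · show 0 < ((1 : ℂ) + ((r / 2 : ℝ) : ℂ) * I).im
      simp only [Complex.add_im, Complex.one_im, Complex.mul_im, Complex.ofReal_re, Complex.I_im,
        mul_one, Complex.ofReal_im, Complex.I_re, mul_zero, add_zero, zero_add]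
      positivity
    · rw [mem_ball, dist_eq_norm, add_sub_cancel_left, norm_mul, Complex.norm_real, Complex.norm_I,
        mul_one, Real.norm_eq_abs, abs_of_pos (by positivity)]
      linarith
  exact IsPathConnected.isConnected ⟨_, hz₀, fun y hy ↦ hjoin _ hz₀ y hy⟩

/-- **`F^{ℝ₊}_ℍ(F) ∈ Ω₊`** for `F ⊆ ℍ̄` closed, connected, unbounded, containing `0` and missing
`(0, ∞)` — the standing properties of `F = cl K_∞` for SLE(8/3, ρ) ([LSW] Lemma 8.3) under which
Thm. 8.4 regards `K = F^{ℝ₊}_ℍ(cl K_∞)` as a random element of `Ω₊` (§8.1 p. 31): `K` is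
closed, connected, in `ℍ̄`, `K ∩ ℝ = (−∞, 0]`, and `ℍ ∖ K` is connected.
[cite: LawlerSchrammWerner2003Restriction, §8.1 p. 31 (Ω₊) with Thm. 8.4 (p. 37) and §2 p. 8 (Fillings)] -/
theorem leftFilling_mem_rightConfigs (hF : IsClosed F) (hsub : F ⊆ {z : ℂ | 0 ≤ z.im})
    (hconn : IsConnected F) (h0 : (0 : ℂ) ∈ F) (hunb : ¬ IsBounded F)
    (hpos : ∀ x : ℝ, 0 < x → (x : ℂ) ∉ F) : leftFilling F ∈ rightConfigs :=
  ⟨isClosed_leftFilling hF, isConnected_leftFilling hF hsub hconn h0 hpos, leftFilling_subset F,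
    leftFilling_inter_range_ofReal hF hsub hconn h0 hunb hpos,
    isConnected_upperHalfPlaneSet_diff_leftFilling hF hsub h0 hpos⟩

/-! ### `+`-hulls avoided by `F` are avoided by its left filling -/

/-- **`F^{ℝ₊}_ℍ(F) ∩ A = ∅ ⟺ F ∩ A = ∅` for `A ∈ 𝒬₊`** when `F` misses `(0, ∞)`: `A ∪ (0, ∞)` is
connected, lies in `ℍ̄ ∖ F` and passes through `1`, so `A` lies in the component of `1`, off the
filling ([LSW] §8.1 p. 31: the avoidance events of the filling are those of the filled set).
[cite: LawlerSchrammWerner2003Restriction, §8.1 p. 31 with §2 p. 8 (Fillings, 𝒬₊)] -/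
theorem disjoint_leftFilling_iff_of_isPlusHull (hpos : ∀ x : ℝ, 0 < x → (x : ℂ) ∉ F) {A : Set ℂ}
    (hA : IsPlusHull A) : Disjoint (leftFilling F) A ↔ Disjoint F A := by
  have hAim : ∀ z ∈ A, 0 ≤ z.im := fun z hz ↦
    RestrictionConfig.im_nonneg_of_mem_isBoundedHull hA.1.isBoundedHull hz
  constructor
  · intro h
    exact Set.disjoint_left.2 fun z hzF hzA ↦
      Set.disjoint_left.1 h (inter_subset_leftFilling F ⟨hzF, hAim z hzA⟩) hzA
  · intro h
    have hsub' : A ∪ ((↑) : ℝ → ℂ) '' Ioi 0 ⊆ {z : ℂ | 0 ≤ z.im} \ F := by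
      rintro z (hz | ⟨x, hx, rfl⟩)
      · exact ⟨hAim z hz, fun hzF ↦ Set.disjoint_left.1 h hzF hz⟩
      · exact ⟨by simp, hpos x hx⟩
    have h1 : (1 : ℂ) ∈ A ∪ ((↑) : ℝ → ℂ) '' Ioi 0 := Or.inr ⟨1, mem_Ioi.2 zero_lt_one, by simp⟩
    have hAcomp : A ⊆ connectedComponentIn ({z : ℂ | 0 ≤ z.im} \ F) 1 :=
      subset_union_left.trans (hA.isPreconnected_union_ofReal_Ioi.subset_connectedComponentIn h1 hsub')
    refine Set.disjoint_left.2 fun z hz hzA ↦ ?_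
    exact (mem_leftFilling_iff.1 hz).2 1 zero_le_one (by exact_mod_cast hAcomp hzA)

end MirrorDouble

end Literature.Probability.RandomPlanarGeometry

end
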